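import Literature.Barriers.PneNP.TSPExtensionComplexityScope
import Literature.Computability.Complexity.CircuitLP
import HarnessLib

/-!
# Barrier catalogue `PneNP`: circuits for HAMILTONIAN CYCLE are HC polytopes of linear size
(Yannakakis 1991, Proposition — the half that no extension-complexity bound can touch)

Companion of `TSPExtensionComplexityScope.lean` (the D-0021 audit of `TSPExtensionComplexity`).
Yannakakis (JCSS 43 (1991), p. 445): "NP has polynomial size circuits (resp. P = NP) if and only
if (for every `n`) there is a polynomial size LP (resp., that can be constructed efficiently)
which expresses a HC polytope." We PROVE the `→` half at a fixed input length, with an explicit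
count: a De Morgan circuit of size `s` deciding Hamiltonicity of subgraphs of `K_n` from their
edge indicators yields a slack-form LP over the edge variables with `5 s` inequalities whose
projection is an HC polytope (`hasHCPolytopeOfSize_of_circuit`, `yannakakis1991_hcPolytope_of_circuit`).
Ingredients: Valiant's gate LP and its `0/1` semantics
(`Literature.Computability.Complexity.circuitLPFeasible_iff`, `…_iff_rows`, file `Literature/Computability/Complexity/CircuitLP.lean`) and the conversion of
a system given by equality / inequality rows into a slack-form extended formulation with one
slack column per inequality (`exists_ef_of_rows`, proved here for the tree's
`ExtendedFormulation`). Hence any super-polynomial lower bound on `HasHCPolytopeOfSize n ·`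
is a super-polynomial De Morgan circuit lower bound for HAMILTONIAN CYCLE, i.e. would prove
`NP ⊄ P/poly`: the decision-LP format is the summit's negation itself, not a barred technique.

(As in Yannakakis' own example `x ≤ z`, an "HC polytope" need not be bounded — `IsHCPolytope`
constrains only the `0/1` points; intersecting with the unit cube would cost `2 |E_n|` more
inequalities and change nothing below.)

**Scope addendum (approximate formulations).** The optimisation-LP results collected in
`TSPExtensionComplexityScope.lean` are all EXACT: no printed theorem bounds the size of a
uniform LP whose optimum merely APPROXIMATES the TSP — Braun–Pokutta–Zink expressly leave "LP
inapproximability of the TSP" open ("the current reductions ... cannot be used as they translate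
feasible solutions depending on the objective functions", arXiv:1410.8816 §8, PDF p. 25). Since
the `{1,2}`-TSP is NP-hard to approximate within some constant `1 + ε₀` (Papadimitriou–
Yannakakis; Karpinski–Lampis–Schmied), a `P = NP` attempt by a polynomial-size LP RELAXATION
certified only to approximate `{1,2}`-TSP within that threshold is, as of the audit, outside
every printed barrier (and no such attempt exists); the expected closure is an affine/gadget
reduction from the LP lower bounds for constraint satisfaction. [cite: BraunPokuttaZink2015, §8 Final Remarks (PDF p. 25)]

## References

* [Yannakakis1991] JCSS 43 (1991), Proposition and proof, p. 445 (held; text checked).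
* [BraunPokuttaZink2015] = arXiv:1410.8816, §8 (PDF p. 25).
-/

noncomputable section

namespace Literature.Barriers.PneNP

open Matrix Literature.Computability.Complexity

/-! ### Systems given by rows are extended formulations -/

/-- `append p q · append v w = p · v + q · w`. [folklore] -/
theorem append_dotProduct_append {a b : ℕ} (p v : Fin a → ℝ) (q w : Fin b → ℝ) :
    Fin.append p q ⬝ᵥ Fin.append v w = p ⬝ᵥ v + q ⬝ᵥ w := by
  simp only [dotProduct]
  rw [Fin.sum_univ_add]
  simp only [Fin.append_left, Fin.append_right]

/-- **Rows form ⇒ slack form.** A system over natural variables `x : ι → ℝ` and `s` sign-constrained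
extra variables `v`, consisting of finitely many linear equations `a_ρ · x + b_ρ · v = d_ρ` and
finitely many linear inequalities `0 ≤ a_σ · x + b_σ · v + c_σ`, is (after one slack variable per
inequality) a slack-form extended formulation with `s + #inequalities` inequalities and the same
projection to `x`. [folklore] -/
theorem exists_ef_of_rows {ι : Type} [Fintype ι] {s : ℕ} {Row Ineq : Type} [Fintype Row]
    [Fintype Ineq] [DecidableEq Ineq]
    (ea : Row → ι → ℝ) (eb : Row → Fin s → ℝ) (ed : Row → ℝ)
    (ia : Ineq → ι → ℝ) (ib : Ineq → Fin s → ℝ) (ic : Ineq → ℝ) :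
    ∃ Q : ExtendedFormulation ι (s + Fintype.card Ineq),
      Q.projSet = {x | ∃ v : Fin s → ℝ, (∀ j, 0 ≤ v j) ∧ (∀ ρ, ea ρ ⬝ᵥ x + eb ρ ⬝ᵥ v = ed ρ) ∧
        ∀ σ, 0 ≤ ia σ ⬝ᵥ x + ib σ ⬝ᵥ v + ic σ} := by
  classical
  set cR := Fintype.card Row
  set cI := Fintype.card Ineq
  set eR : Row ≃ Fin cR := Fintype.equivFin Row
  set eI : Ineq ≃ Fin cI := Fintype.equivFin Ineq
  -- row vectors
  let Erow : Fin (cR + cI) → ι → ℝ := fun i =>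
    Fin.addCases (fun i₁ => ea (eR.symm i₁)) (fun i₂ => ia (eI.symm i₂)) i
  let Frow : Fin (cR + cI) → Fin (s + cI) → ℝ := fun i =>
    Fin.addCases (fun i₁ => Fin.append (eb (eR.symm i₁)) (0 : Fin cI → ℝ))
      (fun i₂ => Fin.append (ib (eI.symm i₂)) (fun j₂ => if j₂ = i₂ then (-1 : ℝ) else 0)) i
  let gv : Fin (cR + cI) → ℝ := fun i =>
    Fin.addCases (fun i₁ => ed (eR.symm i₁)) (fun i₂ => -(ic (eI.symm i₂))) i
  refine ⟨⟨cR + cI, Matrix.of Erow, Matrix.of Frow, gv⟩, ?_⟩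
  -- the system, row by row, on an appended extra vector
  have hsys : ∀ (x : ι → ℝ) (v : Fin s → ℝ) (sl : Fin cI → ℝ),
      (Matrix.of Erow *ᵥ x + Matrix.of Frow *ᵥ Fin.append v sl = gv) ↔
        (∀ ρ, ea ρ ⬝ᵥ x + eb ρ ⬝ᵥ v = ed ρ) ∧
          ∀ σ, ia σ ⬝ᵥ x + ib σ ⬝ᵥ v - sl (eI σ) = -(ic σ) := by
    intro x v sl
    have hrowE : ∀ i, (Matrix.of Erow *ᵥ x) i = Erow i ⬝ᵥ x := fun i => rfl
    have hrowF : ∀ i, (Matrix.of Frow *ᵥ Fin.append v sl) i = Frow i ⬝ᵥ Fin.append v sl :=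
      fun i => rfl
    have hslack : ∀ i₂ : Fin cI,
        (fun j₂ : Fin cI => if j₂ = i₂ then (-1 : ℝ) else 0) ⬝ᵥ sl = -sl i₂ := by
      intro i₂
      simp [dotProduct, ite_mul]
    constructor
    · intro h
      have hi : ∀ i, Erow i ⬝ᵥ x + Frow i ⬝ᵥ Fin.append v sl = gv i := fun i => by
        have := congrFun h i
        rwa [Pi.add_apply, hrowE, hrowF] at this
      constructor
      · intro ρ
        have := hi (Fin.castAdd cI (eR ρ))
        simp only [Erow, Frow, gv, Fin.addCases_left, Equiv.symm_apply_apply,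
          append_dotProduct_append, zero_dotProduct, add_zero] at this
        exact this
      · intro σ
        have := hi (Fin.natAdd cR (eI σ))
        simp only [Erow, Frow, gv, Fin.addCases_right, Equiv.symm_apply_apply,
          append_dotProduct_append, hslack] at this
        rw [← this]
        ring
    · rintro ⟨hρ, hσ⟩
      funext i
      rw [Pi.add_apply, hrowE, hrowF]
      refine Fin.addCases (fun i₁ => ?_) (fun i₂ => ?_) i
      · simp only [Erow, Frow, gv, Fin.addCases_left, append_dotProduct_append, zero_dotProduct,
          add_zero]
        exact hρ _
      · simp only [Erow, Frow, gv, Fin.addCases_right, append_dotProduct_append, hslack]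
        have := hσ (eI.symm i₂)
        rw [Equiv.apply_symm_apply] at this
        rw [← this]
        ring
  ext x
  simp only [ExtendedFormulation.projSet, Set.mem_setOf_eq]
  constructor
  · rintro ⟨w, hw, hE⟩
    rw [← Fin.append_castAdd_natAdd (f := w)] at hE
    obtain ⟨hρ, hσ⟩ := (hsys x _ _).1 hE
    refine ⟨fun j₁ => w (Fin.castAdd cI j₁), fun j => hw _, hρ, fun σ => ?_⟩
    have h1 := hσ σ
    have h2 : 0 ≤ w (Fin.natAdd s (eI σ)) := hw _
    linarith
  · rintro ⟨v, hv, hρ, hσ⟩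
    refine ⟨Fin.append v (fun j₂ => ia (eI.symm j₂) ⬝ᵥ x + ib (eI.symm j₂) ⬝ᵥ v + ic (eI.symm j₂)),
      fun j => ?_, ?_⟩
    · refine Fin.addCases (fun j₁ => ?_) (fun j₂ => ?_) j
      · simpa using hv j₁
      · simpa using hσ (eI.symm j₂)
    · rw [hsys]
      refine ⟨hρ, fun σ => ?_⟩
      simp only [Equiv.symm_apply_apply]
      ring


/-! ### The theorem -/

/-- **A De Morgan circuit for HAMILTONIAN CYCLE of size `s` yields an HC polytope expressed by an
LP with `5 s` inequalities** (Yannakakis 1991, Proposition, via Valiant's gate LP): the rows form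
of Valiant's LP is an extended formulation over the edge variables (`exists_ef_of_rows`), and at
the `0/1` points its feasibility is acceptance by the circuit (`circuitLPFeasible_iff`).
[cite: Yannakakis1991, Proposition (p. 445)] -/
theorem hasHCPolytopeOfSize_of_circuit {n : ℕ} (C : Circuit (Edges n))
    (hB : C.IsOver deMorganBasis) (hC : C.Computes (hamiltonianFn n)) :
    HasHCPolytopeOfSize n (5 * C.size) := by
  classical
  obtain ⟨Q, hQ⟩ := exists_ef_of_rows (fun ρ => (lpEqRow C ρ).1) (fun ρ => (lpEqRow C ρ).2.1)
    (fun ρ => (lpEqRow C ρ).2.2) (fun σ : Fin C.gates.length × Fin 4 => (lpIneqRows C σ.1 σ.2).1)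
    (fun σ => (lpIneqRows C σ.1 σ.2).2.1) (fun σ => (lpIneqRows C σ.1 σ.2).2.2)
  have hproj : Q.projSet = {x | ∃ v, CircuitLPFeasible C x v} := by
    rw [hQ]
    ext x
    simp only [Set.mem_setOf_eq, circuitLPFeasible_iff_rows]
  have hsize : C.gates.length + Fintype.card (Fin C.gates.length × Fin 4) = 5 * C.size := by
    simp only [Fintype.card_prod, Fintype.card_fin, Circuit.size]
    ring
  have h : HasHCPolytopeOfSize n (C.gates.length + Fintype.card (Fin C.gates.length × Fin 4)) := by
    refine ⟨Q, fun z => ?_⟩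
    rw [hproj, Set.mem_setOf_eq]
    have hpt : boolVec z = realPt z := rfl
    rw [hpt, circuitLPFeasible_iff C hB z, hC z]
    simp only [hamiltonianFn]
    exact @decide_eq_true_iff _ (Classical.dec _)
  rwa [hsize] at h

/-- **Yannakakis 1991, Proposition (p. 445), circuit-to-LP half, all input lengths**: for
every `n`, every De Morgan circuit computing HAMILTONIAN CYCLE on the edge indicators of `K_n`
gives an HC polytope expressed with `5 ·` (its size) inequalities. (A theorem, not a named
fact: the explicit constant `5` is this formalisation's slack-form count of the printed gate
system.) [cite: Yannakakis1991, Proposition (p. 445)] -/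
theorem yannakakis1991_hcPolytope_of_circuit :
    ∀ (n : ℕ) (C : Circuit (Edges n)), C.IsOver deMorganBasis → C.Computes (hamiltonianFn n) →
      HasHCPolytopeOfSize n (5 * C.size) :=
  fun _ C hB hC => hasHCPolytopeOfSize_of_circuit C hB hC

end Literature.Barriers.PneNP

end
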